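import Summits.CriticalPhenomena.PercolationContinuityZ3.Theorems.Transplant.PlanarSkeletonFrmQuasiDefs
import Summits.CriticalPhenomena.PercolationContinuityZ3.Theorems.Transplant.SkelFrmQuasiBParamsCorrKGLenY
import Summits.CriticalPhenomena.PercolationContinuityZ3.Theorems.Transplant.SkelFrmBParamsCorrKGLenY
import Summits.CriticalPhenomena.PercolationContinuityZ3.Theorems.Transplant.SkelFrmQuasiBParamsSchedA
import Summits.CriticalPhenomena.PercolationContinuityZ3.Theorems.Transplant.SkelFrmBParamsSchedA
import Summits.CriticalPhenomena.PercolationContinuityZ3.Theorems.Transplant.SkelNegBParamsReachFC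
import Summits.CriticalPhenomena.PercolationContinuityZ3.Theorems.Transplant.SkelFrmQuasi1ParamsLBL
import Summits.CriticalPhenomena.PercolationContinuityZ3.Theorems.Transplant.SkelFrmQuasiBChoiceDefs
import Summits.CriticalPhenomena.PercolationContinuityZ3.Theorems.Transplant.SkelFrmQuasiBParamsLF
import Summits.CriticalPhenomena.PercolationContinuityZ3.Theorems.Transplant.SkelFrmQuasiBParamsLFA
import HarnessLib
import Summits.CriticalPhenomena.PercolationContinuityZ3.Theorems.Transplant.SkelFrmBChoiceWindow
/-!
# GEN-Q PORT (WAVE-Q table v0.8 section 2, row G060, U-level L10; captain R-6/R-7 2026-08-27: carrier token swap `PlanarSkeletonFrmFrom ↦ PlanarSkeletonFrmQuasi`)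
# of the tree module «Transplant/SkelFrmFromBChoiceWindow» (sha256 067c494cea84ec62…) onto the quasi-step carrier `PlanarSkeletonFrmQuasi` (p507026): «SkelFrmQuasiBChoiceWindow»

ORIGINAL TITLE: N2 (frames-only node `SamePDropOfSkeletonFrm₁`, OPEN) — (ζ″) ledger, THE WINDOW SLOT AND THE START-BOX ROWS of the (C) corridor: the SMALL window slot of record

builds on p205010 (kernel theorem, internal audit signed; external expert review pending) — nothing in this file uses p205010; NOTHING is claimed about any open node
((N3-b), the end state).  Lane `prim-bschramm`, seat `prim-bschramm-p3` (gen 30; design owner; tool = captain gen-1 g4's port_genq.py R-14 --cone + p3-g30 slot-value patch T1).  Helper file (`--supports stmt-CriticalPhenomena-4575 --as helper`).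
PORT RULES (U-wave r1–r4 re-used, GEN-Q hunk classes of p3-g29 #6136): declaration order, names and proof texts are those of «SkelFrmFromBChoiceWindow», byte-identical except
(i) the carrier token `PlanarSkeletonFrmFrom ↦ PlanarSkeletonFrmQuasi` in binders, `namespace`/`end` lines and qualified names (module names `SkelFrmFrom… ↦ SkelFrmQuasi…`
in imports of already-ported rows); (ii) `Φ.step ↦ Φ.qstep` with the called Steps lemma replaced by its `…Q`/`_q` twin and the cost `Φ.M` threaded (none in this file unless
listed below); (iii) `Φ.cyl_connected ↦ Φ.cyl_reach` readers (none unless listed); (iv) graph-ball radii / window floors ×`Φ.M` (none unless listed).  Carrier-free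
residents stay imported/exported from the original «SkelFrmBChoiceWindow» exactly as in the FrmFrom port.  Docstrings and citations are the original's.

-/

open scoped Classical

noncomputable section

namespace Summit.CriticalPhenomena.PercolationContinuityZ3.Theorems.Transplant

namespace PlanarSkeletonFrmQuasi

namespace NegB

open Literature.Probability.Percolation Literature.Probability.LatticeModels SimpleGraph KNCells
open SkelConc (Consts)
open Skelφ (shearUnit kgSL)
open TwoAxis.Para (modulus)
open Neg

/-! ## §1 The small window slot -/

/-- **The window slot of record**: `b := (30·s₀, 8·s₁)` (fine units; along generous — the along reading of the arrival box carries the shear coupling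
`≈ s₀·(|v_L|/n_L)·(rows/sL) ≤ 19·s₀` — across small). [this work] -/
def BSlot.small : BSlot := fun κ _ _ _ _ _ Φ t p D g f i => (if i = 0 then 30 else 8) * (fcellsA κ Φ t p D g f).s i

section Small

variable (κ : Consts) {V : Type} [DecidableEq V] [Countable V] {G : SimpleGraph V} [G.LocallyFinite] (Φ : PlanarSkeletonFrmQuasi G) (t : V) (p : unitInterval)
  (D : Skelφ.StepI.DataNS V) (g f : ℕ)

/-- `small 0 = 30·s₀`, `small 1 = 8·s₁`. [folklore] -/
theorem small_eq (κ : Consts) {V : Type} [DecidableEq V] [Countable V] {G : SimpleGraph V} [G.LocallyFinite] (Φ : PlanarSkeletonFrmQuasi G) (t : V) (p : unitInterval) (D : Skelφ.StepI.DataNS V) (g : ℕ) (f : ℕ) : BSlot.small κ Φ t p D g f 0 = 30 * (fcellsA κ Φ t p D g f).s 0 ∧ BSlot.small κ Φ t p D g f 1 = 8 * (fcellsA κ Φ t p D g f).s 1 :=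
  ⟨rfl, rfl⟩

-- GEN-Q (R-2, captain 2026-08-27): `PlanarSkeletonFrmFrom.NegB.small_le_thirty` is not in the used cone of the node top — not ported.

-- GEN-Q (R-2, captain 2026-08-27): `PlanarSkeletonFrmFrom.NegB.small_pos` is not in the used cone of the node top — not ported.

-- GEN-Q (R-2, captain 2026-08-27): `PlanarSkeletonFrmFrom.NegB.small_le` is not in the used cone of the node top — not ported.

end Small

/-! ## §2 The start-box half-widths at `prFA` for any window `b`, and the three rows -/

section StartBox

variable (κ : Consts) {V : Type} [DecidableEq V] [Countable V] {G : SimpleGraph V} [G.LocallyFinite] (Φ : PlanarSkeletonFrmQuasi G) (t : V) (p : unitInterval)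
  (D : Skelφ.StepI.DataNS V) (g f : ℕ) (b : Fin 2 → ℕ)

/-- **The start box's α-half-width** `aW := ⌈D·(c₁·n·(b₀+1) + c₀·|vα|·(b₁+1)) / (c₀·c₁·A·m)⌉` (as floor + 1) at `prFA`. [this work] -/
def aWS (κ : Consts) {V : Type} [DecidableEq V] [Countable V] {G : SimpleGraph V} [G.LocallyFinite] (Φ : PlanarSkeletonFrmQuasi G) (t : V) (p : unitInterval) (D : Skelφ.StepI.DataNS V) (g : ℕ) (f : ℕ) (b : Fin 2 → ℕ) : ℤ :=
  (prFA κ Φ t p D g f).D * ((prFA κ Φ t p D g f).c₁ * (prFA κ Φ t p D g f).n * ((b 0 : ℤ) + 1) +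
      (prFA κ Φ t p D g f).c₀ * |(prFA κ Φ t p D g f).vα| * ((b 1 : ℤ) + 1)) /
    ((prFA κ Φ t p D g f).c₀ * (prFA κ Φ t p D g f).c₁ * (prFA κ Φ t p D g f).A *
      modulus (prFA κ Φ t p D g f).n (prFA κ Φ t p D g f).h (prFA κ Φ t p D g f).vα (prFA κ Φ t p D g f).vβ) + 1

/-- **The β′-extent of the box** `Bx := ⌈D·(b₁+1) / (c₁·A)⌉` at `prFA`. [this work] -/
def BxS (κ : Consts) {V : Type} [DecidableEq V] [Countable V] {G : SimpleGraph V} [G.LocallyFinite] (Φ : PlanarSkeletonFrmQuasi G) (t : V) (p : unitInterval) (D : Skelφ.StepI.DataNS V) (g : ℕ) (f : ℕ) (b : Fin 2 → ℕ) : ℤ := (prFA κ Φ t p D g f).D * ((b 1 : ℤ) + 1) / ((prFA κ Φ t p D g f).c₁ * (prFA κ Φ t p D g f).A) + 1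

/-- **The start box's half-width in rows** `bL := Bx / U + 1`. [this work] -/
def bLS (κ : Consts) {V : Type} [DecidableEq V] [Countable V] {G : SimpleGraph V} [G.LocallyFinite] (Φ : PlanarSkeletonFrmQuasi G) (t : V) (p : unitInterval) (D : Skelφ.StepI.DataNS V) (g : ℕ) (f : ℕ) (b : Fin 2 → ℕ) : ℤ := BxS κ Φ t p D g f b / (shearUnit (nL κ Φ t p D g f) (hL κ Φ t p D g f) : ℤ) + 1

/-- **The identities of `prFA`**: `A = Aof κ > 0`, `D = A²·m`, `c₀ = A·s₀`, `c₁ = A·s₁`, `0 < m`, `n = n_L`, `vα = v_L` (under `EqNumL`). [folklore] -/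
theorem prFA_ids (κ : Consts) {V : Type} [DecidableEq V] [Countable V] {G : SimpleGraph V} [G.LocallyFinite] (Φ : PlanarSkeletonFrmQuasi G) (t : V) (p : unitInterval) (D : Skelφ.StepI.DataNS V) (g : ℕ) (f : ℕ) (hN : EqNumL κ Φ t p D g f) :
    (prFA κ Φ t p D g f).A = Aof κ ∧ 0 < Aof κ ∧
    (prFA κ Φ t p D g f).D = Aof κ ^ 2 * modulus (prFA κ Φ t p D g f).n (prFA κ Φ t p D g f).h (prFA κ Φ t p D g f).vα (prFA κ Φ t p D g f).vβ ∧
    (prFA κ Φ t p D g f).c₀ = Aof κ * (((fcellsA κ Φ t p D g f).s 0 : ℕ) : ℤ) ∧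
    (prFA κ Φ t p D g f).c₁ = Aof κ * (((fcellsA κ Φ t p D g f).s 1 : ℕ) : ℤ) ∧
    0 < modulus (prFA κ Φ t p D g f).n (prFA κ Φ t p D g f).h (prFA κ Φ t p D g f).vα (prFA κ Φ t p D g f).vβ ∧
    (prFA κ Φ t p D g f).n = nL κ Φ t p D g f ∧ (prFA κ Φ t p D g f).vα = vL κ Φ t p D g f := by
  obtain ⟨hn1, hℓ1⟩ := one_le_of_eqNumL κ Φ t p D g f hN
  have hK : ((fcellsA κ Φ t p D g f).K : ℤ) = Neg.K κ := by exact_mod_cast (fcellsA_K κ Φ t p D g f).1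
  refine ⟨rfl, (Aof_pos κ).1, ?_, ?_, ?_, ?_, rfl, rfl⟩
  · exact Skelφ.NegPrm.DofA_eq _ _ _ _ _
  · show 20 * ((fcellsA κ Φ t p D g f).K : ℤ) * (((fcellsA κ Φ t p D g f).s 0 : ℕ) : ℤ) = _
    rw [hK, Aof_eq_K]
  · show 20 * ((fcellsA κ Φ t p D g f).K : ℤ) * (((fcellsA κ Φ t p D g f).s 1 : ℕ) : ℤ) = _
    rw [hK, Aof_eq_K]
  · exact Skelφ.NegPrm.modulus_vβOf_pos hn1 hℓ1 _ _

/-- **`ha`** of `runX_mem_Icc_of_fine` at `K := b`, `aW := aWS b`. [folklore] -/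
theorem ha_S (κ : Consts) {V : Type} [DecidableEq V] [Countable V] {G : SimpleGraph V} [G.LocallyFinite] (Φ : PlanarSkeletonFrmQuasi G) (t : V) (p : unitInterval) (D : Skelφ.StepI.DataNS V) (g : ℕ) (f : ℕ) (b : Fin 2 → ℕ) (hN : EqNumL κ Φ t p D g f) :
    (prFA κ Φ t p D g f).D * ((prFA κ Φ t p D g f).c₁ * ((prFA κ Φ t p D g f).n : ℤ) * ((b 0 : ℤ) + 1) +
        (prFA κ Φ t p D g f).c₀ * |(prFA κ Φ t p D g f).vα| * ((b 1 : ℤ) + 1)) ≤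
      (prFA κ Φ t p D g f).c₀ * (prFA κ Φ t p D g f).c₁ * (prFA κ Φ t p D g f).A *
        modulus (prFA κ Φ t p D g f).n (prFA κ Φ t p D g f).h (prFA κ Φ t p D g f).vα (prFA κ Φ t p D g f).vβ * aWS κ Φ t p D g f b := by
  obtain ⟨hA, hA0, -, -, -, hm, -⟩ := prFA_ids κ Φ t p D g f hN
  obtain ⟨hc₀, hc₁⟩ := prFA_c_pos κ Φ t p D g f
  unfold aWS
  rw [hA]
  exact PlanarSkeletonNeg.NegB.ceil_mul_le (by positivity)

/-- **`hBx`**: `D·(b₁+1) ≤ c₁·A·BxS`. [folklore] -/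
theorem hBx_S (κ : Consts) {V : Type} [DecidableEq V] [Countable V] {G : SimpleGraph V} [G.LocallyFinite] (Φ : PlanarSkeletonFrmQuasi G) (t : V) (p : unitInterval) (D : Skelφ.StepI.DataNS V) (g : ℕ) (f : ℕ) (b : Fin 2 → ℕ) (hN : EqNumL κ Φ t p D g f) :
    (prFA κ Φ t p D g f).D * ((b 1 : ℤ) + 1) ≤ (prFA κ Φ t p D g f).c₁ * (prFA κ Φ t p D g f).A * BxS κ Φ t p D g f b := by
  obtain ⟨hA, hA0, -⟩ := prFA_ids κ Φ t p D g f hN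
  obtain ⟨-, hc₁⟩ := prFA_c_pos κ Φ t p D g f
  unfold BxS
  rw [hA]
  exact PlanarSkeletonNeg.NegB.ceil_mul_le (by positivity)

/-- **`hb`**: `BxS / U + 1 ≤ bLS` (`rfl`). [folklore] -/
theorem hb_S (κ : Consts) {V : Type} [DecidableEq V] [Countable V] {G : SimpleGraph V} [G.LocallyFinite] (Φ : PlanarSkeletonFrmQuasi G) (t : V) (p : unitInterval) (D : Skelφ.StepI.DataNS V) (g : ℕ) (f : ℕ) (b : Fin 2 → ℕ) : BxS κ Φ t p D g f b / (shearUnit (nL κ Φ t p D g f) (hL κ Φ t p D g f) : ℤ) + 1 ≤ bLS κ Φ t p D g f b := le_rfl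

/-- **THE ALONG HALF-WIDTH IS `O(n_L)` FOR A SMALL WINDOW**: `aWS b ≤ (e₀ + e₁ + 1)·n_L` whenever `b 0 + 1 ≤ e₀·s₀` and `|v_L|·(b 1 + 1) ≤ e₁·n_L·s₁`
(after cancelling `A³·m`: `aW − 1 = ⌊(s₁·n·(b₀+1) + s₀·|v|·(b₁+1))/(s₀·s₁)⌋ < (e₀ + e₁ + 1)·n`). [this work] -/
theorem aWS_le_of (κ : Consts) {V : Type} [DecidableEq V] [Countable V] {G : SimpleGraph V} [G.LocallyFinite] (Φ : PlanarSkeletonFrmQuasi G) (t : V) (p : unitInterval) (D : Skelφ.StepI.DataNS V) (g : ℕ) (f : ℕ) (b : Fin 2 → ℕ) {e₀ e₁ : ℤ} (hN : EqNumL κ Φ t p D g f) (hb0 : (b 0 : ℤ) + 1 ≤ e₀ * (((fcellsA κ Φ t p D g f).s 0 : ℕ) : ℤ))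
    (hb1 : |vL κ Φ t p D g f| * ((b 1 : ℤ) + 1) ≤ e₁ * (nL κ Φ t p D g f : ℤ) * (((fcellsA κ Φ t p D g f).s 1 : ℕ) : ℤ)) :
    aWS κ Φ t p D g f b ≤ (e₀ + e₁ + 1) * (nL κ Φ t p D g f : ℤ) := by
  obtain ⟨hA, hA0, hD, hc₀, hc₁, hm, hn, hv⟩ := prFA_ids κ Φ t p D g f hN
  have hn1 : (1 : ℤ) ≤ ((prFA κ Φ t p D g f).n : ℤ) := by rw [hn]; exact_mod_cast (one_le_of_eqNumL κ Φ t p D g f hN).1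
  have hb1' : |(prFA κ Φ t p D g f).vα| * ((b 1 : ℤ) + 1) ≤ e₁ * ((prFA κ Φ t p D g f).n : ℤ) * (((fcellsA κ Φ t p D g f).s 1 : ℕ) : ℤ) := by
    rw [hv, hn]; exact hb1
  have hs0 : (1 : ℤ) ≤ (((fcellsA κ Φ t p D g f).s 0 : ℕ) : ℤ) := by exact_mod_cast (fcellsA κ Φ t p D g f).hs 0
  have hs1 : (1 : ℤ) ≤ (((fcellsA κ Φ t p D g f).s 1 : ℕ) : ℤ) := by exact_mod_cast (fcellsA κ Φ t p D g f).hs 1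
  have hgoal : (e₀ + e₁ + 1) * (nL κ Φ t p D g f : ℤ) = (e₀ + e₁ + 1) * ((prFA κ Φ t p D g f).n : ℤ) := by rw [hn]
  rw [hgoal]
  unfold aWS
  rw [hD, hc₀, hc₁, hA]
  set A := Aof κ with hAdef
  set m := modulus (prFA κ Φ t p D g f).n (prFA κ Φ t p D g f).h (prFA κ Φ t p D g f).vα (prFA κ Φ t p D g f).vβ with hmdef
  set s0 := (((fcellsA κ Φ t p D g f).s 0 : ℕ) : ℤ) with hs0def
  set s1 := (((fcellsA κ Φ t p D g f).s 1 : ℕ) : ℤ) with hs1def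
  set n := ((prFA κ Φ t p D g f).n : ℤ) with hndef
  set va := |(prFA κ Φ t p D g f).vα| with hvadef
  have hb00 : (0 : ℤ) ≤ (b 0 : ℤ) := by positivity
  have hb10 : (0 : ℤ) ≤ (b 1 : ℤ) := by positivity
  have hva : (0 : ℤ) ≤ va := abs_nonneg _
  -- X / Y + 1 ≤ (e₀+e₁+1) n  ⟸  X < (e₀+e₁+1) n · Y
  have hY : 0 < A * s0 * (A * s1) * A * m := by positivity
  have h1 : s1 * n * ((b 0 : ℤ) + 1) ≤ e₀ * (s0 * s1 * n) := by
    calc s1 * n * ((b 0 : ℤ) + 1) = (s1 * n) * ((b 0 : ℤ) + 1) := by ring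
      _ ≤ (s1 * n) * (e₀ * s0) := mul_le_mul_of_nonneg_left hb0 (by positivity)
      _ = e₀ * (s0 * s1 * n) := by ring
  have h2 : s0 * (va * ((b 1 : ℤ) + 1)) ≤ e₁ * (s0 * s1 * n) := by
    calc s0 * (va * ((b 1 : ℤ) + 1)) ≤ s0 * (e₁ * n * s1) := mul_le_mul_of_nonneg_left hb1' (by positivity)
      _ = e₁ * (s0 * s1 * n) := by ring
  have hssn : 1 ≤ s0 * s1 * n := by
    have := mul_le_mul hs0 hs1 (by norm_num) (by positivity)
    nlinarith
  have h3 : s1 * n * ((b 0 : ℤ) + 1) + s0 * (va * ((b 1 : ℤ) + 1)) < (e₀ + e₁ + 1) * (s0 * s1 * n) := by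
    have e : (e₀ + e₁ + 1) * (s0 * s1 * n) = e₀ * (s0 * s1 * n) + e₁ * (s0 * s1 * n) + s0 * s1 * n := by ring
    rw [e]; linarith
  have hkey : A * s1 * n * ((b 0 : ℤ) + 1) + A * s0 * va * ((b 1 : ℤ) + 1) < (e₀ + e₁ + 1) * n * (A * s0 * s1) := by
    calc A * s1 * n * ((b 0 : ℤ) + 1) + A * s0 * va * ((b 1 : ℤ) + 1) = A * (s1 * n * ((b 0 : ℤ) + 1) + s0 * (va * ((b 1 : ℤ) + 1))) := by ring
      _ < A * ((e₀ + e₁ + 1) * (s0 * s1 * n)) := mul_lt_mul_of_pos_left h3 hA0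
      _ = (e₀ + e₁ + 1) * n * (A * s0 * s1) := by ring
  have hA2m : 0 < A ^ 2 * m := by positivity
  have hX : A ^ 2 * m * (A * s1 * n * ((b 0 : ℤ) + 1) + A * s0 * va * ((b 1 : ℤ) + 1)) < (e₀ + e₁ + 1) * n * (A * s0 * (A * s1) * A * m) := by
    calc A ^ 2 * m * (A * s1 * n * ((b 0 : ℤ) + 1) + A * s0 * va * ((b 1 : ℤ) + 1))
        < A ^ 2 * m * ((e₀ + e₁ + 1) * n * (A * s0 * s1)) := mul_lt_mul_of_pos_left hkey hA2m
      _ = (e₀ + e₁ + 1) * n * (A * s0 * (A * s1) * A * m) := by ring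
  have := Int.ediv_lt_of_lt_mul hY hX
  linarith

-- GEN-Q (R-2, captain 2026-08-27): `PlanarSkeletonFrmFrom.NegB.aWS_le` is not in the used cone of the node top — not ported.

-- GEN-Q (R-2, captain 2026-08-27): `PlanarSkeletonFrmFrom.NegB.small_rows` is not in the used cone of the node top — not ported.

-- GEN-Q (R-2, captain 2026-08-27): `PlanarSkeletonFrmFrom.NegB.aWS_small_le` is not in the used cone of the node top — not ported.

/-- **`BxS` after cancelling `A²`**: `BxS b = ⌊m·(b₁+1)/s₁⌋ + 1`. [folklore] -/
theorem BxS_eq (κ : Consts) {V : Type} [DecidableEq V] [Countable V] {G : SimpleGraph V} [G.LocallyFinite] (Φ : PlanarSkeletonFrmQuasi G) (t : V) (p : unitInterval) (D : Skelφ.StepI.DataNS V) (g : ℕ) (f : ℕ) (b : Fin 2 → ℕ) (hN : EqNumL κ Φ t p D g f) :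
    BxS κ Φ t p D g f b = modulus (prFA κ Φ t p D g f).n (prFA κ Φ t p D g f).h (prFA κ Φ t p D g f).vα (prFA κ Φ t p D g f).vβ * ((b 1 : ℤ) + 1) /
      (((fcellsA κ Φ t p D g f).s 1 : ℕ) : ℤ) + 1 := by
  obtain ⟨hA, hA0, hD, -, hc₁, -, -, -⟩ := prFA_ids κ Φ t p D g f hN
  unfold BxS
  rw [hD, hc₁, hA]
  have e1 : Aof κ ^ 2 * modulus (prFA κ Φ t p D g f).n (prFA κ Φ t p D g f).h (prFA κ Φ t p D g f).vα (prFA κ Φ t p D g f).vβ * ((b 1 : ℤ) + 1) =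
      (Aof κ * Aof κ) * (modulus (prFA κ Φ t p D g f).n (prFA κ Φ t p D g f).h (prFA κ Φ t p D g f).vα (prFA κ Φ t p D g f).vβ * ((b 1 : ℤ) + 1)) := by ring
  have e2 : Aof κ * (((fcellsA κ Φ t p D g f).s 1 : ℕ) : ℤ) * Aof κ = (Aof κ * Aof κ) * (((fcellsA κ Φ t p D g f).s 1 : ℕ) : ℤ) := by ring
  rw [e1, e2, Int.mul_ediv_mul_of_pos _ _ (by positivity)]

/-- **THE ACROSS HALF-WIDTH IS `O(sL)` FOR A SMALL WINDOW**: `bLS b ≤ e·sL + 2e + 2` whenever `b 1 + 1 ≤ e·s₁` (`m ≤ n_Lℓ_L < (sL+2)·U`). [this work] -/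
theorem bLS_le (κ : Consts) {V : Type} [DecidableEq V] [Countable V] {G : SimpleGraph V} [G.LocallyFinite] (Φ : PlanarSkeletonFrmQuasi G) (t : V) (p : unitInterval) (D : Skelφ.StepI.DataNS V) (g : ℕ) (f : ℕ) (b : Fin 2 → ℕ) {e : ℤ} (he : 0 ≤ e) (hN : EqNumL κ Φ t p D g f) (hb1 : (b 1 : ℤ) + 1 ≤ e * (((fcellsA κ Φ t p D g f).s 1 : ℕ) : ℤ)) :
    bLS κ Φ t p D g f b ≤ e * kgSL (nL κ Φ t p D g f) (ℓL κ Φ t p D g f) (hL κ Φ t p D g f) + 2 * e + 2 := by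
  obtain ⟨-, -, -, -, -, hm, hn, hv⟩ := prFA_ids κ Φ t p D g f hN
  obtain ⟨hn1, hℓ1⟩ := one_le_of_eqNumL κ Φ t p D g f hN
  have hs1 : (0 : ℤ) < (((fcellsA κ Φ t p D g f).s 1 : ℕ) : ℤ) := by exact_mod_cast (fcellsA κ Φ t p D g f).hs 1
  have hU : (0 : ℤ) < (shearUnit (nL κ Φ t p D g f) (hL κ Φ t p D g f) : ℕ) := Skelφ.shearUnit_pos hn1 _
  have hBx := BxS_eq κ Φ t p D g f b hN
  set m := modulus (prFA κ Φ t p D g f).n (prFA κ Φ t p D g f).h (prFA κ Φ t p D g f).vα (prFA κ Φ t p D g f).vβ with hmdef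
  set s1 := (((fcellsA κ Φ t p D g f).s 1 : ℕ) : ℤ) with hs1def
  set U := ((shearUnit (nL κ Φ t p D g f) (hL κ Φ t p D g f) : ℕ) : ℤ) with hUdef
  -- m ≤ nℓ and nℓ < (sL + 2)·U
  have hmle : m ≤ (nL κ Φ t p D g f : ℤ) * ℓL κ Φ t p D g f := by
    have := (Skelφ.NegPrm.modulus_vβOf hn1 (hL κ Φ t p D g f) (ℓL κ Φ t p D g f) (vL κ Φ t p D g f)).2
    rw [hmdef, hn, hv]; exact this
  have hlt := Int.lt_ediv_add_one_mul_self ((nL κ Φ t p D g f : ℤ) * ℓL κ Φ t p D g f - U + 1) hU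
  have hsLe : ((nL κ Φ t p D g f : ℤ) * ℓL κ Φ t p D g f - U + 1) / U = kgSL (nL κ Φ t p D g f) (ℓL κ Φ t p D g f) (hL κ Φ t p D g f) := rfl
  rw [hsLe] at hlt
  set sL := kgSL (nL κ Φ t p D g f) (ℓL κ Φ t p D g f) (hL κ Φ t p D g f) with hsLdef
  -- BxS ≤ e·m + 1
  have h1 : m * ((b 1 : ℤ) + 1) / s1 ≤ e * m := by
    have : m * ((b 1 : ℤ) + 1) ≤ (e * m) * s1 := by nlinarith
    calc m * ((b 1 : ℤ) + 1) / s1 ≤ (e * m) * s1 / s1 := Int.ediv_le_ediv hs1 this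
      _ = e * m := Int.mul_ediv_cancel _ (ne_of_gt hs1)
  have hBx' : BxS κ Φ t p D g f b ≤ e * m + 1 := by rw [hBx]; linarith
  -- bLS = BxS/U + 1 ≤ (e nℓ + U)/U + 1 = e·nℓ/U + 2 ≤ e sL + 2e + 2
  have h2 : BxS κ Φ t p D g f b / U ≤ (e * ((nL κ Φ t p D g f : ℤ) * ℓL κ Φ t p D g f) + 1 * U) / U :=
    Int.ediv_le_ediv hU (by nlinarith)
  rw [Int.add_mul_ediv_right _ _ (ne_of_gt hU)] at h2
  have h3 : e * ((nL κ Φ t p D g f : ℤ) * ℓL κ Φ t p D g f) / U < e * sL + 2 * e + 1 := by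
    apply Int.ediv_lt_of_lt_mul hU
    have : e * ((nL κ Φ t p D g f : ℤ) * ℓL κ Φ t p D g f) ≤ e * ((sL + 2) * U - 1) := mul_le_mul_of_nonneg_left (by linarith) he
    nlinarith
  unfold bLS
  linarith

-- GEN-Q (R-2, captain 2026-08-27): `PlanarSkeletonFrmFrom.NegB.small_row_across` is not in the used cone of the node top — not ported.

end StartBox

/-! ## §3 The residual values of record and the start-box row `haq` -/

section Residuals

variable (κ : Consts) {V : Type} [DecidableEq V] [Countable V] {G : SimpleGraph V} [G.LocallyFinite] (Φ : PlanarSkeletonFrmQuasi G) (t : V) (p : unitInterval)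
  (D : Skelφ.StepI.DataNS V) (g f : ℕ)

-- GEN-Q (R-2, captain 2026-08-27): `PlanarSkeletonFrmFrom.NegB.qxQ` is not in the used cone of the node top — not ported.

-- GEN-Q (R-2, captain 2026-08-27): `PlanarSkeletonFrmFrom.NegB.WxQ` is not in the used cone of the node top — not ported.

-- GEN-Q (R-2, captain 2026-08-27): `PlanarSkeletonFrmFrom.NegB.kgRes_Q` is not in the used cone of the node top — not ported.

-- GEN-Q (R-2, captain 2026-08-27): `PlanarSkeletonFrmFrom.NegB.haq_S` is not in the used cone of the node top — not ported.

-- GEN-Q (R-2, captain 2026-08-27): `PlanarSkeletonFrmFrom.NegB.haq_small` is not in the used cone of the node top — not ported.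

/-! ### Second axis: the start-box rows `haWm/haWp/hbq` at `(qxYQ, WxYQ) := ((9·sL).toNat + 19, 39·n_L)` -/

-- GEN-Q (R-2, captain 2026-08-27): `PlanarSkeletonFrmFrom.NegB.qxYQ` is not in the used cone of the node top — not ported.

-- GEN-Q (R-2, captain 2026-08-27): `PlanarSkeletonFrmFrom.NegB.WxYQ` is not in the used cone of the node top — not ported.

-- GEN-Q (R-2, captain 2026-08-27): `PlanarSkeletonFrmFrom.NegB.kgResY_Q` is not in the used cone of the node top — not ported.

-- GEN-Q (R-2, captain 2026-08-27): `PlanarSkeletonFrmFrom.NegB.haW_small` is not in the used cone of the node top — not ported.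

-- GEN-Q (R-2, captain 2026-08-27): `PlanarSkeletonFrmFrom.NegB.hbq_small` is not in the used cone of the node top — not ported.

-- GEN-Q (R-2, captain 2026-08-27): `PlanarSkeletonFrmFrom.NegB.hbW_S` is not in the used cone of the node top — not ported.

-- GEN-Q (R-2, captain 2026-08-27): `PlanarSkeletonFrmFrom.NegB.hbW_small` is not in the used cone of the node top — not ported.

end Residuals

end NegB

end PlanarSkeletonFrmQuasi

end Summit.CriticalPhenomena.PercolationContinuityZ3.Theorems.Transplant

end
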